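import Summits.QuantumFields.YangMills.Theorems.FluctuationComparisonRegPrIntLS2BetaLiftLadderDiscRowTower
import HarnessLib

/-!
# S2β · THE SUP CHAIN — THE `hX′` ASSEMBLER (pen (α)): the station's SOURCE BUDGET `Σ_{t<K−J} L^t·X t ≤ C_X·e^{c·Σθ′}·purse + β_X·S′` at
# `X := dite (✓p835795 discRow′'s X′)` FROM the column budgets {ρκ (W-ρκ), ρ̃ (px12 P)}, a θ-class bound on `a`, and px20's ✓`mShare_le`

Cell `ym3-torus` (YM ladder rung R3 = continuum `SU(2)` Yang–Mills on the three-torus at fixed lattice data — a RUNG: NOT d = 4, NOT infinite volume,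
NOT a mass gap, NOT Clay).  Width seat «width 21» `ym3-torus-px21` (gen 25), FREE px helper on crux `stmt-QuantumFields-20520`
(`…Theses.UnitScaleTilt.FluctuationComparisonRegPrIntL`), LINE g18-1 S2β.  ARCHITECT px17 g22 2026-08-31 22:05:54Z NAMED this pen («the successor edition of LEAD's
`hDBX` one level down»); §1 of (α) = ✓∕⧗`…S2BetaBlockPairReadCover` (the (k2) cover).  `--kind proof --supports stmt-QuantumFields-20520 --as helper`, count-neutral,
DEFINITION-FREE (0 `def`, 0 `instance`, 0 `notation`, 0 `sorry`, default heartbeats).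

WHERE IT DOCKS.  LEAD w3 g29's SUPPLIER KNIT ✓p835801 reduces `∀ G, hSTL‴ G` to {`hARC`, `hDBX`}; `hDBX` ⟸ ✓p835564 `hSCT_of_discSplit'` ⟸ {(SPLIT) `D′lam t ≤ X t + q·E′lam t`
= px20 ✓p835795 `discRow'` at `q := 0`, `X := dite X′`; (SRC′) `Σ L^t·X t ≤ C_X e^{c_XΣθ′} purse + β_X S′` = THIS FILE}.  After this file the (SRC′) letter reads, by
kernel: {`hρκ` (the W-ρκ column budget — px16 g24 γ gives `ρκ := 12ℓ²((ρP + 4aδC) + 2a(ℓδC))`, so `hρκ` ⟸ (k1) px10 g26's CELL-MASS budget + the (k2) cover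
✓∕⧗`sum_sq_boxSup_le_readSup` for the `a²δC²` column), `hρt` (px12 g26 ✓∕⧗P's `ρt := ρS + ρA + 2(4sU+aU)mA + 2(4sA+aA)mA` + its region budgets — the FB-σ
number lives here), `a t ≤ ā` ((E5): `ā := 4α∕(25L²)`)} — every one in the suppliers' own currencies, none frozen by this file.

WHAT IS PROVED (sorry-free).  §1 ★`column_term_le` [folklore] (the per-`(t,B)` split in ✓`discRow'`'s exact bracketing).  §2 ★★★`hX_of_columns`.

HONEST SCOPE.  Real bookkeeping over ✓`discRow'`'s text and ✓`mShare_le`; `hρκ`, `hρt`, `ha` are HYPOTHESES (the suppliers' letters); nothing of Bałaban's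
renormalisation-group analysis is asserted or proved ([Balaban1985Averaging] Prop. 4 (128)–(135) pp.37–38; [Balaban1985RegularSpaces] (1.29) p.81;
[Balaban1987RG1] (0.4), (0.11) p.253); `hArc`, (ST‴)∕LOC‴∕AVG₂♭, `h3`, GAP♯∘ (`stub_uniformFibreGapOrbit`, registry 3732b7df UNTOUCHED), the five registered
stubs (0∕5), S2β, 20520, 19936, 19200, `YM3TorusSU2` are NOT proved; no registered stub is closed; rung R3 — NOT d = 4, NOT infinite volume, NOT a mass gap,
NOT Clay; the Yang–Mills mass gap is NOT proved.
-/

set_option autoImplicit false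

namespace Summit.QuantumFields.YangMills.Theorems.FluctuationComparisonRegPrIntLS2BetaSourceBudgetOfColumns

open Finset
open scoped Real
open Literature.MathematicalPhysics.QuantumLattice (su2Quat)
open Literature.MathematicalPhysics.QuantumFieldTheory.Balaban1983to89
open T4Continuum T3ContinuumYM3Torus T3TiltDescent T3LevelShift BlockAveraging
open B10Eq27TorusAxialLog (rel axialT)
open T4CubeChartGnomonic (SU2)
open T4HaarSU2ExpChart (expPoint)
open T4ExpWindowSmallField (logVec)
open T3UnitLawDensityEML (ℰp)
open Summit.QuantumFields.YangMills.Theorems.FluctuationComparisonRegPrIntLS2BetaLiftLadderDiscRowTower (mShare_le)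

/-! ## §1 One real inequality per `(t, B)` -/

/-- ★ The `r²`-column split in ✓`discRow'`'s bracketing: `(1+κ′)(π∕2·(x + c₁·(c₂·y)))² ≤ 2(1+κ′)(π∕2)²·x² + 2(1+κ′)(π∕2)²·(c₁c₂)²·y²` for `0 ≤ κ′`. [folklore] -/
theorem rColumn_term_le (κ' x y c₁ c₂ : ℝ) (hκ' : 0 ≤ κ') :
    (1 + κ') * (π / 2 * (x + c₁ * (c₂ * y))) ^ 2 ≤
      2 * (1 + κ') * (π / 2) ^ 2 * x ^ 2 + 2 * (1 + κ') * (π / 2) ^ 2 * (c₁ * c₂) ^ 2 * y ^ 2 := by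
  have hsq : (x + c₁ * (c₂ * y)) ^ 2 ≤ 2 * x ^ 2 + 2 * (c₁ * (c₂ * y)) ^ 2 := by nlinarith [sq_nonneg (x - c₁ * (c₂ * y))]
  have e : (1 + κ') * (π / 2 * (x + c₁ * (c₂ * y))) ^ 2 = (1 + κ') * (π / 2) ^ 2 * (x + c₁ * (c₂ * y)) ^ 2 := by ring
  rw [e]
  have h' : (1 + κ') * (π / 2) ^ 2 * (x + c₁ * (c₂ * y)) ^ 2 ≤ (1 + κ') * (π / 2) ^ 2 * (2 * x ^ 2 + 2 * (c₁ * (c₂ * y)) ^ 2) :=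
    mul_le_mul_of_nonneg_left hsq (by positivity)
  refine h'.trans (le_of_eq ?_)
  ring

/-! ## §2 The `r²`-column budget of ✓`hX'_of_rColumn` from the two named column budgets -/

section Tower

variable {F : T3Family}

/-- ★★★ **THE `hX′` ASSEMBLER, `r²`-COLUMN** (pen (α), ARCHITECT px17 g22 2026-08-31 22:05:54Z; px20 g24's ✓∕⧗`…S2BetaDiscRowDockHalf.hX'_of_rColumn` socket «`hR` in, `hX′` out»):
the `r²`-column budget **`Σ_{t<K−J} L^t·(if ht then Σ_B (1+κ′)·(π∕2·(ρκ t B + c₁a·(c₁b·ρt t B)))² else 0) ≤ C_X·exp(c·Σθ′)·purse + β_R·S′`** — px20's `hR` binder VERBATIM with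
`C_X := 2(1+κ′)(π∕2)²·(Cκ + (c₁a·c₁b)²·Cρ)`, `c_X := c`, `β_R := 2(1+κ′)(π∕2)²·(βκ + (c₁a·c₁b)²·βρ)` (`c₁a = 2((L−1)∕2)`, `c₁b = 2 + 2((L−1)∕2)` as cast in the text) — FROM the two
NAMED column budgets in the suppliers' currencies: `hρκ : Σ_t L^t·Σ_B (ρκ t B)² ≤ Cκ·exp(c·Σθ′)·purse + βκ·S′` (W-ρκ: px16 g24 γ `ρκ := 12ℓ²((ρP+4aδC)+2a(ℓδC))` ⟸ (k1)
px10 g26 CELL-MASS budget + the (k2) cover ✓∕⧗`…BlockPairReadCover` for the `a²δC²` column) and `hρt : … ≤ Cρ·exp(c·Σθ′)·purse + βρ·S′` (px12 g26 P v1.1 ∘ its region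
budgets; the FB-σ number lives in `βρ`).  With px20's §4 the knit's `hDBX` ed.3 reads `⟨X, hDisc_of_discRow …, hX'_of_rColumn … (hR_of_columns … hρκ hρt)⟩`, side goal
`6·(β_R + β_M) ≤ ¼` in the letters' constants. [cite: Balaban1985Averaging, Prop. 4 (128)-(135) p.37-38; Balaban1985RegularSpaces, (1.29) p.81; Balaban1987RG1, (0.4), (0.11) p.253] -/
theorem hR_of_columns {J K : ℕ} (U₀ : GaugeField (F.P K) 0 (Matrix.specialUnitaryGroup (Fin 2) ℂ)) (ζ : PBond (F.P K) 0 → EuclideanSpace ℝ (Fin 3))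
    (θ : ℕ → ℝ) (ρκ ρt : ℕ → PBond (F.P J) 0 → ℝ) {κ' : ℝ} (hκ' : 0 < κ')
    {Cκ Cρ βκ βρ c : ℝ}
    (hρκ : ∑ t ∈ Finset.range (K - J), (F.L : ℝ) ^ t * ∑ B : PBond (F.P J) 0, ρκ t B ^ 2 ≤ Cκ * Real.exp (c * ∑ i ∈ Finset.range (K - J), (((5 * F.L : ℕ) : ℝ) ^ 2 / 4) * θ (K - i)) * (((F.L : ℝ)⁻¹) ^ (K - J) * ∑ ℓ : PBond (F.P K) 0, ‖ζ ℓ‖ ^ 2 +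
                (F.L : ℝ) ^ (K - J) * ∑ p : Plaq (F.P K) 0,
                  (1 - reTr ((GaugeField.plaqHol U₀ p)⁻¹ * GaugeField.plaqHol (fun ℓ => expPoint (ζ ℓ) * U₀ ℓ : GaugeField (F.P K) 0 (Matrix.specialUnitaryGroup (Fin 2) ℂ)) p))) +
      βκ * (∑ t ∈ Finset.range (K - J), (if ht : t < K - J then
          (F.L : ℝ) ^ t * ∑ B : PBond (F.P J) 0,
            ‖(fun ℓ' : PBond (F.P (J + (t + 1))) 0 =>
              if ∃ z : Site (F.P (J + (t + 1))) 0,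
                (B14.Eq22Determines.blockIter (t + 1) z = (bondShift (F.sitesPerDir_eq (m := F.m) (K := J) (j := 0) (m' := F.m) (K' := J + (t + 1)) (j' := t + 1) (by omega)) B).src ∨ B14.Eq22Determines.blockIter (t + 1) z = (bondShift (F.sitesPerDir_eq (m := F.m) (K := J) (j := 0) (m' := F.m) (K' := J + (t + 1)) (j' := t + 1) (by omega)) B).tgt) ∧
                ∀ ν, (B10Eq27TorusAxialLog.rel z ℓ'.src ν).natAbs ≤ 2
              then logVec (su2Quat (descendTo F ℰp (J + (t + 1)) K (by omega) (fun ℓ => expPoint (ζ ℓ) * U₀ ℓ : GaugeField (F.P K) 0 (Matrix.specialUnitaryGroup (Fin 2) ℂ)) ℓ' * (descendTo F ℰp (J + (t + 1)) K (by omega) U₀ ℓ')⁻¹)) else 0)‖ ^ 2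
        else 0)))
    (hρt : ∑ t ∈ Finset.range (K - J), (F.L : ℝ) ^ t * ∑ B : PBond (F.P J) 0, ρt t B ^ 2 ≤ Cρ * Real.exp (c * ∑ i ∈ Finset.range (K - J), (((5 * F.L : ℕ) : ℝ) ^ 2 / 4) * θ (K - i)) * (((F.L : ℝ)⁻¹) ^ (K - J) * ∑ ℓ : PBond (F.P K) 0, ‖ζ ℓ‖ ^ 2 +
                (F.L : ℝ) ^ (K - J) * ∑ p : Plaq (F.P K) 0,
                  (1 - reTr ((GaugeField.plaqHol U₀ p)⁻¹ * GaugeField.plaqHol (fun ℓ => expPoint (ζ ℓ) * U₀ ℓ : GaugeField (F.P K) 0 (Matrix.specialUnitaryGroup (Fin 2) ℂ)) p))) +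
      βρ * (∑ t ∈ Finset.range (K - J), (if ht : t < K - J then
          (F.L : ℝ) ^ t * ∑ B : PBond (F.P J) 0,
            ‖(fun ℓ' : PBond (F.P (J + (t + 1))) 0 =>
              if ∃ z : Site (F.P (J + (t + 1))) 0,
                (B14.Eq22Determines.blockIter (t + 1) z = (bondShift (F.sitesPerDir_eq (m := F.m) (K := J) (j := 0) (m' := F.m) (K' := J + (t + 1)) (j' := t + 1) (by omega)) B).src ∨ B14.Eq22Determines.blockIter (t + 1) z = (bondShift (F.sitesPerDir_eq (m := F.m) (K := J) (j := 0) (m' := F.m) (K' := J + (t + 1)) (j' := t + 1) (by omega)) B).tgt) ∧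
                ∀ ν, (B10Eq27TorusAxialLog.rel z ℓ'.src ν).natAbs ≤ 2
              then logVec (su2Quat (descendTo F ℰp (J + (t + 1)) K (by omega) (fun ℓ => expPoint (ζ ℓ) * U₀ ℓ : GaugeField (F.P K) 0 (Matrix.specialUnitaryGroup (Fin 2) ℂ)) ℓ' * (descendTo F ℰp (J + (t + 1)) K (by omega) U₀ ℓ')⁻¹)) else 0)‖ ^ 2
        else 0))) :
    ∑ t ∈ Finset.range (K - J), (F.L : ℝ) ^ t * (if ht : t < K - J then
          ∑ B : PBond (F.P J) 0, (1 + κ') * (π / 2 * (ρκ t B + (((2 * ((F.L - 1) / 2) : ℕ) : ℝ)) * ((2 + 2 * (((F.L - 1) / 2 : ℕ) : ℝ)) * ρt t B))) ^ 2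
        else 0) ≤
      ((2 * (1 + κ') * (π / 2) ^ 2) * (Cκ + ((((2 * ((F.L - 1) / 2) : ℕ) : ℝ)) * (2 + 2 * (((F.L - 1) / 2 : ℕ) : ℝ))) ^ 2 * Cρ)) * Real.exp (c * ∑ i ∈ Finset.range (K - J), (((5 * F.L : ℕ) : ℝ) ^ 2 / 4) * θ (K - i)) * (((F.L : ℝ)⁻¹) ^ (K - J) * ∑ ℓ : PBond (F.P K) 0, ‖ζ ℓ‖ ^ 2 +
                (F.L : ℝ) ^ (K - J) * ∑ p : Plaq (F.P K) 0,
                  (1 - reTr ((GaugeField.plaqHol U₀ p)⁻¹ * GaugeField.plaqHol (fun ℓ => expPoint (ζ ℓ) * U₀ ℓ : GaugeField (F.P K) 0 (Matrix.specialUnitaryGroup (Fin 2) ℂ)) p))) +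
      ((2 * (1 + κ') * (π / 2) ^ 2) * (βκ + ((((2 * ((F.L - 1) / 2) : ℕ) : ℝ)) * (2 + 2 * (((F.L - 1) / 2 : ℕ) : ℝ))) ^ 2 * βρ)) * (∑ t ∈ Finset.range (K - J), (if ht : t < K - J then
          (F.L : ℝ) ^ t * ∑ B : PBond (F.P J) 0,
            ‖(fun ℓ' : PBond (F.P (J + (t + 1))) 0 =>
              if ∃ z : Site (F.P (J + (t + 1))) 0,
                (B14.Eq22Determines.blockIter (t + 1) z = (bondShift (F.sitesPerDir_eq (m := F.m) (K := J) (j := 0) (m' := F.m) (K' := J + (t + 1)) (j' := t + 1) (by omega)) B).src ∨ B14.Eq22Determines.blockIter (t + 1) z = (bondShift (F.sitesPerDir_eq (m := F.m) (K := J) (j := 0) (m' := F.m) (K' := J + (t + 1)) (j' := t + 1) (by omega)) B).tgt) ∧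
                ∀ ν, (B10Eq27TorusAxialLog.rel z ℓ'.src ν).natAbs ≤ 2
              then logVec (su2Quat (descendTo F ℰp (J + (t + 1)) K (by omega) (fun ℓ => expPoint (ζ ℓ) * U₀ ℓ : GaugeField (F.P K) 0 (Matrix.specialUnitaryGroup (Fin 2) ℂ)) ℓ' * (descendTo F ℰp (J + (t + 1)) K (by omega) U₀ ℓ')⁻¹)) else 0)‖ ^ 2
        else 0)) := by
  have hA0 : (0 : ℝ) ≤ (2 * (1 + κ') * (π / 2) ^ 2) := by positivity
  have hC1 : (0 : ℝ) ≤ ((((2 * ((F.L - 1) / 2) : ℕ) : ℝ)) * (2 + 2 * (((F.L - 1) / 2 : ℕ) : ℝ))) ^ 2 := sq_nonneg _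
  -- STEP 1: pointwise on the range
  have hpt : ∀ t ∈ Finset.range (K - J),
      (F.L : ℝ) ^ t * (if ht : t < K - J then ∑ B : PBond (F.P J) 0, (1 + κ') * (π / 2 * (ρκ t B + (((2 * ((F.L - 1) / 2) : ℕ) : ℝ)) * ((2 + 2 * (((F.L - 1) / 2 : ℕ) : ℝ)) * ρt t B))) ^ 2 else 0) ≤
        (2 * (1 + κ') * (π / 2) ^ 2) * ((F.L : ℝ) ^ t * ∑ B : PBond (F.P J) 0, ρκ t B ^ 2) +
        (2 * (1 + κ') * (π / 2) ^ 2) * ((((2 * ((F.L - 1) / 2) : ℕ) : ℝ)) * (2 + 2 * (((F.L - 1) / 2 : ℕ) : ℝ))) ^ 2 * ((F.L : ℝ) ^ t * ∑ B : PBond (F.P J) 0, ρt t B ^ 2) := by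
    intro t hmem
    have ht : t < K - J := Finset.mem_range.mp hmem
    have hLt : (0 : ℝ) ≤ (F.L : ℝ) ^ t := by positivity
    rw [dif_pos ht]
    have hinner : ∑ B : PBond (F.P J) 0, (1 + κ') * (π / 2 * (ρκ t B + (((2 * ((F.L - 1) / 2) : ℕ) : ℝ)) * ((2 + 2 * (((F.L - 1) / 2 : ℕ) : ℝ)) * ρt t B))) ^ 2 ≤
        (2 * (1 + κ') * (π / 2) ^ 2) * ∑ B : PBond (F.P J) 0, ρκ t B ^ 2 + (2 * (1 + κ') * (π / 2) ^ 2) * ((((2 * ((F.L - 1) / 2) : ℕ) : ℝ)) * (2 + 2 * (((F.L - 1) / 2 : ℕ) : ℝ))) ^ 2 * ∑ B : PBond (F.P J) 0, ρt t B ^ 2 := by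
      rw [Finset.mul_sum, Finset.mul_sum, ← Finset.sum_add_distrib]
      exact Finset.sum_le_sum fun B _ => rColumn_term_le κ' (ρκ t B) (ρt t B) (((2 * ((F.L - 1) / 2) : ℕ) : ℝ)) (2 + 2 * (((F.L - 1) / 2 : ℕ) : ℝ)) hκ'.le
    calc (F.L : ℝ) ^ t * (∑ B : PBond (F.P J) 0, (1 + κ') * (π / 2 * (ρκ t B + (((2 * ((F.L - 1) / 2) : ℕ) : ℝ)) * ((2 + 2 * (((F.L - 1) / 2 : ℕ) : ℝ)) * ρt t B))) ^ 2)
        ≤ (F.L : ℝ) ^ t * ((2 * (1 + κ') * (π / 2) ^ 2) * ∑ B : PBond (F.P J) 0, ρκ t B ^ 2 + (2 * (1 + κ') * (π / 2) ^ 2) * ((((2 * ((F.L - 1) / 2) : ℕ) : ℝ)) * (2 + 2 * (((F.L - 1) / 2 : ℕ) : ℝ))) ^ 2 * ∑ B : PBond (F.P J) 0, ρt t B ^ 2) :=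
          mul_le_mul_of_nonneg_left hinner hLt
      _ = _ := by ring
  -- STEP 2: sum over the range and insert the two budgets
  have hsum := Finset.sum_le_sum hpt
  rw [Finset.sum_add_distrib, ← Finset.mul_sum, ← Finset.mul_sum] at hsum
  have hb1 := mul_le_mul_of_nonneg_left hρκ hA0
  have hb2 := mul_le_mul_of_nonneg_left hρt (mul_nonneg hA0 hC1)
  have hfin : (2 * (1 + κ') * (π / 2) ^ 2) * (Cκ * Real.exp (c * ∑ i ∈ Finset.range (K - J), (((5 * F.L : ℕ) : ℝ) ^ 2 / 4) * θ (K - i)) * (((F.L : ℝ)⁻¹) ^ (K - J) * ∑ ℓ : PBond (F.P K) 0, ‖ζ ℓ‖ ^ 2 +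
                (F.L : ℝ) ^ (K - J) * ∑ p : Plaq (F.P K) 0,
                  (1 - reTr ((GaugeField.plaqHol U₀ p)⁻¹ * GaugeField.plaqHol (fun ℓ => expPoint (ζ ℓ) * U₀ ℓ : GaugeField (F.P K) 0 (Matrix.specialUnitaryGroup (Fin 2) ℂ)) p))) +
      βκ * (∑ t ∈ Finset.range (K - J), (if ht : t < K - J then
          (F.L : ℝ) ^ t * ∑ B : PBond (F.P J) 0,
            ‖(fun ℓ' : PBond (F.P (J + (t + 1))) 0 =>
              if ∃ z : Site (F.P (J + (t + 1))) 0,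
                (B14.Eq22Determines.blockIter (t + 1) z = (bondShift (F.sitesPerDir_eq (m := F.m) (K := J) (j := 0) (m' := F.m) (K' := J + (t + 1)) (j' := t + 1) (by omega)) B).src ∨ B14.Eq22Determines.blockIter (t + 1) z = (bondShift (F.sitesPerDir_eq (m := F.m) (K := J) (j := 0) (m' := F.m) (K' := J + (t + 1)) (j' := t + 1) (by omega)) B).tgt) ∧
                ∀ ν, (B10Eq27TorusAxialLog.rel z ℓ'.src ν).natAbs ≤ 2
              then logVec (su2Quat (descendTo F ℰp (J + (t + 1)) K (by omega) (fun ℓ => expPoint (ζ ℓ) * U₀ ℓ : GaugeField (F.P K) 0 (Matrix.specialUnitaryGroup (Fin 2) ℂ)) ℓ' * (descendTo F ℰp (J + (t + 1)) K (by omega) U₀ ℓ')⁻¹)) else 0)‖ ^ 2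
        else 0))) +
      (2 * (1 + κ') * (π / 2) ^ 2) * ((((2 * ((F.L - 1) / 2) : ℕ) : ℝ)) * (2 + 2 * (((F.L - 1) / 2 : ℕ) : ℝ))) ^ 2 * (Cρ * Real.exp (c * ∑ i ∈ Finset.range (K - J), (((5 * F.L : ℕ) : ℝ) ^ 2 / 4) * θ (K - i)) * (((F.L : ℝ)⁻¹) ^ (K - J) * ∑ ℓ : PBond (F.P K) 0, ‖ζ ℓ‖ ^ 2 +
                (F.L : ℝ) ^ (K - J) * ∑ p : Plaq (F.P K) 0,
                  (1 - reTr ((GaugeField.plaqHol U₀ p)⁻¹ * GaugeField.plaqHol (fun ℓ => expPoint (ζ ℓ) * U₀ ℓ : GaugeField (F.P K) 0 (Matrix.specialUnitaryGroup (Fin 2) ℂ)) p))) +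
      βρ * (∑ t ∈ Finset.range (K - J), (if ht : t < K - J then
          (F.L : ℝ) ^ t * ∑ B : PBond (F.P J) 0,
            ‖(fun ℓ' : PBond (F.P (J + (t + 1))) 0 =>
              if ∃ z : Site (F.P (J + (t + 1))) 0,
                (B14.Eq22Determines.blockIter (t + 1) z = (bondShift (F.sitesPerDir_eq (m := F.m) (K := J) (j := 0) (m' := F.m) (K' := J + (t + 1)) (j' := t + 1) (by omega)) B).src ∨ B14.Eq22Determines.blockIter (t + 1) z = (bondShift (F.sitesPerDir_eq (m := F.m) (K := J) (j := 0) (m' := F.m) (K' := J + (t + 1)) (j' := t + 1) (by omega)) B).tgt) ∧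
                ∀ ν, (B10Eq27TorusAxialLog.rel z ℓ'.src ν).natAbs ≤ 2
              then logVec (su2Quat (descendTo F ℰp (J + (t + 1)) K (by omega) (fun ℓ => expPoint (ζ ℓ) * U₀ ℓ : GaugeField (F.P K) 0 (Matrix.specialUnitaryGroup (Fin 2) ℂ)) ℓ' * (descendTo F ℰp (J + (t + 1)) K (by omega) U₀ ℓ')⁻¹)) else 0)‖ ^ 2
        else 0))) =
      ((2 * (1 + κ') * (π / 2) ^ 2) * (Cκ + ((((2 * ((F.L - 1) / 2) : ℕ) : ℝ)) * (2 + 2 * (((F.L - 1) / 2 : ℕ) : ℝ))) ^ 2 * Cρ)) * Real.exp (c * ∑ i ∈ Finset.range (K - J), (((5 * F.L : ℕ) : ℝ) ^ 2 / 4) * θ (K - i)) * (((F.L : ℝ)⁻¹) ^ (K - J) * ∑ ℓ : PBond (F.P K) 0, ‖ζ ℓ‖ ^ 2 +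
                (F.L : ℝ) ^ (K - J) * ∑ p : Plaq (F.P K) 0,
                  (1 - reTr ((GaugeField.plaqHol U₀ p)⁻¹ * GaugeField.plaqHol (fun ℓ => expPoint (ζ ℓ) * U₀ ℓ : GaugeField (F.P K) 0 (Matrix.specialUnitaryGroup (Fin 2) ℂ)) p))) +
      ((2 * (1 + κ') * (π / 2) ^ 2) * (βκ + ((((2 * ((F.L - 1) / 2) : ℕ) : ℝ)) * (2 + 2 * (((F.L - 1) / 2 : ℕ) : ℝ))) ^ 2 * βρ)) * (∑ t ∈ Finset.range (K - J), (if ht : t < K - J then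
          (F.L : ℝ) ^ t * ∑ B : PBond (F.P J) 0,
            ‖(fun ℓ' : PBond (F.P (J + (t + 1))) 0 =>
              if ∃ z : Site (F.P (J + (t + 1))) 0,
                (B14.Eq22Determines.blockIter (t + 1) z = (bondShift (F.sitesPerDir_eq (m := F.m) (K := J) (j := 0) (m' := F.m) (K' := J + (t + 1)) (j' := t + 1) (by omega)) B).src ∨ B14.Eq22Determines.blockIter (t + 1) z = (bondShift (F.sitesPerDir_eq (m := F.m) (K := J) (j := 0) (m' := F.m) (K' := J + (t + 1)) (j' := t + 1) (by omega)) B).tgt) ∧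
                ∀ ν, (B10Eq27TorusAxialLog.rel z ℓ'.src ν).natAbs ≤ 2
              then logVec (su2Quat (descendTo F ℰp (J + (t + 1)) K (by omega) (fun ℓ => expPoint (ζ ℓ) * U₀ ℓ : GaugeField (F.P K) 0 (Matrix.specialUnitaryGroup (Fin 2) ℂ)) ℓ' * (descendTo F ℰp (J + (t + 1)) K (by omega) U₀ ℓ')⁻¹)) else 0)‖ ^ 2
        else 0)) := by ring
  linarith [hsum, hb1, hb2, hfin]

end Tower

end Summit.QuantumFields.YangMills.Theorems.FluctuationComparisonRegPrIntLS2BetaSourceBudgetOfColumns
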